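import Summits.QuantumFields.YangMills.Theorems.BalabanUVNodesN19CoreKnitSanity
import HarnessLib

/-!
# BalabanUVNodes ∕ N19 centre synchronisation — hazard H-U5b-1 FOR THE E-LEDGER discharged BY NAME from the in-edges
# N22 (NE9 ∧ fading memory) · N18 (NE5) · N17 (node U2's coupling rate); the N19 knit v2 with binder (D) replaced by the
# other-kinds centre clause (cell `pub-ymgap`, D-0062 Track A, cluster K5, seat dag-n19-a gen 2; count-neutral)

HONEST FRAMING.  One fixed finite four-torus, rung (B)+1 — NOT infinite volume, NOT a mass gap, NOT the Clay problem.  NE7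
(node U5; NE7-proper leaf `Spine.NE7.Core`) is NOT PRINTED in [Balaban1987RG1]–[Balaban1989LargeFieldII] and NOT PROVED here.
Every analytic input is a HYPOTHESIS SHAPE of the tree consumed BY NAME; nothing of Bałaban's objects is instantiated; no
`def`, 0 `sorry`, standard axioms.  NOT a node discharge: a `--supports` helper for crux `SpineGivenEndpoint` (19182).

WHAT THIS ADDS TO `BalabanUVNodesN19CoreKnit` (p409134).  The discharge referee's read of that knit (ref-B READ #17) states
N19's own residue as binder (D) `hdevU` = hazard H-U5b-1 (the per-term CENTRES `Cc K t τ` are `(t, τ)`-independent up to a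
summable `vol·s_K`) and the format binders (F).  The knit's centre is `Σ_{j ≤ K} sliceCentre κ₁ κ₂ S ρ j + cO`: per creation
scale EITHER the one-run SIZE centre `κ₁` (radius `S`) OR the RATE centre `κ₂ j = Σ_{scale X = j} c_X`,
`c_X = −(E^B(X; g^B, 1_B) − E^A(X; g^A, 1_A))` (radius `ρ_j = Cw·vol·Cr θ′^jΛ^{K−j}`), whichever radius is smaller.  The
tree's `T4TowerRateComposition.abs_const_sub_le` shows the `c_X` are RATE-SMALL from NE9 + NE5 + the coupling bracket,
«whose volume bookkeeping is NOT done here»; this file does it.  §1 ([folklore] real bookkeeping): with the (2.43)-FAITHFUL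
size centre `κ₁ ≡ 0` (Thm 2 (2.43) p. 263 of [Balaban1988Convergent] bounds the `1`-subtracted E-terms themselves; the twin
`BalabanUVNodesN19SizeWindow.sizeBinder_of_thm2Printed` is zero-centred) and `|κ₂ j| ≤ ρ_j`, a size-centred slice contributes
`0` and a rate-centred one has `ρ_j < S_j`, so `Σ_j |sliceCentre 0 κ₂ S ρ j|` is at most THE KNIT'S OWN crossover radius
`vol·max(Cw,1)(E_K + Cr)Σ_{j+n=K}min(aⁿ, θ′^jΛⁿ)` (summable, `N19CoreKnit.summable_eBranch_windowSize`).  §2: rate-small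
constants + multiplicity ((0.26), one run) ⇒ `|κ₂ j| ≤ ρ_j`; and the constants ARE rate-small at every cutoff with constant
`b + C₅`, `b = C₉·(γ³·2c∕(1−θc))·θ′∕(θ′ − max(ω,θc))`, from N22 · N18 · node U2's output for the two runs' re-indexed tables
(`injectedRate_of_runs_eventual` from N17 and its displayed inputs) + the ONE structural hypothesis `C.transport oneB = oneA`.
§3 THE KNIT v2 `core_summable_of_spineNodes_sync`: `N19CoreKnit.core_summable_of_spineNodes` with the size binder zero-centred
and (D) REPLACED by `hone` + the OTHER-KINDS CENTRE CLAUSE (O′) `∃ c₀ s, Summable s ∧ |cO K t τ − c₀ K| ≤ vol·s_K` ⇒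
`∃ δ, Spine.NE7.Core l₀ vol T Bad P Q δ ∧ Summable δ` (`Cr = a₀ + b + C₅ ≥ b + C₅`, so §1 applies with the knit's own `ρ`).
§4 non-vacuity on the toy data of `BalabanUVNodesN19CoreKnitSanity`.

BINDER CENSUS OF THE EDGE AFTER THIS FILE.  (D) for the E-LEDGER: GONE — N17 · N18 · N22 by name + `hone`.  Remaining, not a
sibling node's statement: (F) the synchronised two-run TERM FORMAT (object-bound; dagwriter's `S_N27x` ∕ the crux's
`stub_classExpansionAtRecord`); (O′) = `hO` + `hcO`: the OTHER KINDS (R-kind, boundary, run B's first step, N14's D-terms, the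
extracted vacuum-energy ∕ normalization constants — [Balaban1988Convergent] p. 262 «The constant E_k (depending on {Ω_j},
{Λ_j} also) …», [Balaban1989LargeFieldII] p. 380 «the corresponding constant O(log g_j^{−2})») match per good term with a
CLASS constant, `|log o^B − log o^A − c₀ K| ≤ vol·(rO K + s K)` — sibling rows (`T4BoundaryRate`, NE-R1's `uv_*` fields of
`T4MatchingClosure.ReindexedBudget`, `Spine/NE1p`) with `T4GoodClassBudget.RecentDeviation`'s window cut for their constants;
(S)(M)(T) printed-grade; `hlo` the unprinted floor behind (0.31).  N19's E-kind content on the term-wise road = the three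
brackets of `T4OutputRate.u3_threeBrackets` at the trivial AND the driven backgrounds — both now by name.

CITATION HEADER (LOCATIONS only, as transcribed in the imported modules; no decl carries a cite tag).  [Balaban1988Convergent]
T. Bałaban, CMP **119** (1988) 243–285 — (2.25)–(2.27) p. 259, Thm 2 (2.43) p. 263, p. 262.  [Balaban1987RG1] CMP **109**
(1987) 249–301 — (0.26) p. 257; (0.31), Thm 2 p. 259 (the conditional behind `EventualLowerH`, NEVER used as a result).
[Balaban1989LargeFieldII] CMP **122** (1989) 355–392 — p. 356, p. 380.  [King1986] CMP **102** (1986) 649–677, (3.10)–(3.13).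
-/

open Finset MeasureTheory

namespace Summit.QuantumFields.YangMills.BalabanUVNodes.N19CentreSync

open Literature.MathematicalPhysics.QuantumFieldTheory.Balaban1983to89
open T4OutputRate T4RecentScale T4GoodClassBudget T4CauchySum T4TowerRateComposition T4TowerRateDischarge
open T4TermwiseBudget
open T4EtaRateMin (Readings LocalRate NE3Shape)
open T4RateLiaison (GaugeDominated)
open Summit.QuantumFields.BalabanUV.T4Continuum.Spine
open Summit.QuantumFields.YangMills.BalabanUVNodes.N19CoreKnit

/-! ## §1 Real bookkeeping: with the size centre `0`, the chosen centres sum to at most the crossover radius -/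

section Bookkeeping

/-- ONE SLICE: with the size centre `0` the chosen centre is `0` (size-centred) or `κ₂ j` with `ρ j < S j` (rate-centred); so
any `M ≥ 0` bounding `|κ₂ j|` in the rate-centred case bounds it. [folklore] -/
theorem abs_sliceCentre_zero_le {κ₂ S ρ : ℕ → ℝ} {j : ℕ} {M : ℝ} (hM : 0 ≤ M)
    (hrate : ρ j < S j → |κ₂ j| ≤ M) : |sliceCentre (fun _ => 0) κ₂ S ρ j| ≤ M := by
  unfold sliceCentre
  split_ifs with h
  · rwa [abs_zero]
  · exact hrate (not_le.mp h)

/-- **THE VOLUME BOOKKEEPING OF H-U5b-1 FOR THE E-LEDGER.**  Size centre `0`, rate centres within their radii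
(`|κ₂ j| ≤ ρ j`), SIZE radii `S j ≤ vol·E·a^{K−j}`, RATE radii `ρ j ≤ Cw·vol·(Cr θ^j Λ^{K−j})` ⇒
`Σ_{j ≤ K} |sliceCentre 0 κ₂ S ρ j| ≤ vol·max(Cw,1)·(E + Cr)·Σ_{j+n=K} min(aⁿ, θ^j Λⁿ)` — the SAME majorant as the knit's
radius (`T4TermwiseBudget.sliceMin_le_eShape`): each chosen centre is `0` or below BOTH branch majorants. [folklore] -/
theorem sum_abs_sliceCentre_zero_le {κ₂ S ρ : ℕ → ℝ} {vol Cw E a θ Λ Cr : ℝ} {K : ℕ} (hvol : 0 ≤ vol)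
    (hE : 0 ≤ E) (ha : 0 ≤ a) (hθ : 0 ≤ θ) (hΛ : 0 ≤ Λ) (hCr : 0 ≤ Cr)
    (hκ : ∀ j ≤ K, |κ₂ j| ≤ ρ j)
    (hS : ∀ j ≤ K, S j ≤ vol * (E * a ^ (K - j)))
    (hρ : ∀ j ≤ K, ρ j ≤ Cw * vol * (Cr * θ ^ j * Λ ^ (K - j))) :
    ∑ j ∈ range (K + 1), |sliceCentre (fun _ => 0) κ₂ S ρ j|
      ≤ vol * (max Cw 1 * ((E + Cr) * ∑ x ∈ antidiagonal K, min (a ^ x.2) (θ ^ x.1 * Λ ^ x.2))) := by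
  set Cv := vol * max Cw 1 with hCv
  have h1v : vol ≤ Cv :=
    calc vol = vol * 1 := (mul_one _).symm
      _ ≤ vol * max Cw 1 := mul_le_mul_of_nonneg_left (le_max_right _ _) hvol
  have hCwv : Cw * vol ≤ Cv := by
    rw [hCv, mul_comm Cw]
    exact mul_le_mul_of_nonneg_left (le_max_left _ _) hvol
  have hCv0 : 0 ≤ Cv := mul_nonneg hvol (zero_le_one.trans (le_max_right _ _))
  have hx0 : ∀ j, 0 ≤ E * a ^ (K - j) := fun j => mul_nonneg hE (pow_nonneg ha _)
  have hy0 : ∀ j, 0 ≤ Cr * θ ^ j * Λ ^ (K - j) := fun j =>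
    mul_nonneg (mul_nonneg hCr (pow_nonneg hθ _)) (pow_nonneg hΛ _)
  have hc1 : ∀ j ≤ K, |sliceCentre (fun _ => 0) κ₂ S ρ j| ≤ Cv * (E * a ^ (K - j)) := fun j hj =>
    abs_sliceCentre_zero_le (mul_nonneg hCv0 (hx0 j)) fun hlt =>
      ((hκ j hj).trans hlt.le).trans ((hS j hj).trans (mul_le_mul_of_nonneg_right h1v (hx0 j)))
  have hc2 : ∀ j ≤ K, |sliceCentre (fun _ => 0) κ₂ S ρ j| ≤ Cv * (Cr * θ ^ j * Λ ^ (K - j)) := fun j hj =>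
    abs_sliceCentre_zero_le (mul_nonneg hCv0 (hy0 j)) fun _ =>
      (hκ j hj).trans ((hρ j hj).trans (mul_le_mul_of_nonneg_right hCwv (hy0 j)))
  have hsum := sum_min_le_crossoverShape (S := fun j => |sliceCentre (fun _ => 0) κ₂ S ρ j|)
    (ρ := fun j => |sliceCentre (fun _ => 0) κ₂ S ρ j|) (SZ := fun j => E * a ^ (K - j)) hc1 hc2
  simp only [min_self] at hsum
  have hbr : ∑ x ∈ antidiagonal K, min (E * a ^ (K - x.1)) (Cr * θ ^ x.1 * Λ ^ x.2)
      ≤ (E + Cr) * ∑ x ∈ antidiagonal K, min (a ^ x.2) (θ ^ x.1 * Λ ^ x.2) := by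
    refine sum_min_le_eBranch (SZ := fun j => E * a ^ (K - j)) (add_nonneg hE hCr) hθ hΛ (by linarith)
      fun x hx => ?_
    have hx' : K - x.1 = x.2 := by have := mem_antidiagonal.mp hx; omega
    show E * a ^ (K - x.1) ≤ (E + Cr) * a ^ x.2
    rw [hx']
    exact mul_le_mul_of_nonneg_right (by linarith) (pow_nonneg ha _)
  calc ∑ j ∈ range (K + 1), |sliceCentre (fun _ => 0) κ₂ S ρ j|
      ≤ Cv * ∑ x ∈ antidiagonal K, min (E * a ^ (K - x.1)) (Cr * θ ^ x.1 * Λ ^ x.2) := hsum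
    _ ≤ Cv * ((E + Cr) * ∑ x ∈ antidiagonal K, min (a ^ x.2) (θ ^ x.1 * Λ ^ x.2)) :=
        mul_le_mul_of_nonneg_left hbr hCv0
    _ = vol * (max Cw 1 * ((E + Cr) * ∑ x ∈ antidiagonal K, min (a ^ x.2) (θ ^ x.1 * Λ ^ x.2))) := by
        rw [hCv]; ring

/-- **THE TERM CENTRE AGAINST THE CLASS CONSTANT**: §1's bound plus an other-kinds centre within `vol·s` of `c₀` give the
`hdev` binder shape of `N19CoreKnit.termBudget_of_towerRate_sizeProfile` with `κ₁ ≡ 0`. [folklore] -/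
theorem abs_centre_sub_le {κ₂ S ρ : ℕ → ℝ} {vol Cw E a θ Λ Cr cO c₀ s : ℝ} {K : ℕ} (hvol : 0 ≤ vol)
    (hE : 0 ≤ E) (ha : 0 ≤ a) (hθ : 0 ≤ θ) (hΛ : 0 ≤ Λ) (hCr : 0 ≤ Cr)
    (hκ : ∀ j ≤ K, |κ₂ j| ≤ ρ j)
    (hS : ∀ j ≤ K, S j ≤ vol * (E * a ^ (K - j)))
    (hρ : ∀ j ≤ K, ρ j ≤ Cw * vol * (Cr * θ ^ j * Λ ^ (K - j)))
    (hcO : |cO - c₀| ≤ vol * s) :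
    |((∑ j ∈ range (K + 1), sliceCentre (fun _ => 0) κ₂ S ρ j) + cO) - c₀|
      ≤ vol * (max Cw 1 * ((E + Cr) * ∑ x ∈ antidiagonal K, min (a ^ x.2) (θ ^ x.1 * Λ ^ x.2)) + s) := by
  have h1 := (abs_sum_le_sum_abs _ _).trans (sum_abs_sliceCentre_zero_le hvol hE ha hθ hΛ hCr hκ hS hρ)
  rw [add_sub_assoc, mul_add]
  exact (abs_add_le _ _).trans (add_le_add h1 hcO)

end Bookkeeping

/-! ## §2 The rate centres are within their radii: rate-small constants + multiplicity; the constants from the nodes -/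

section Constants

variable {C : Carriers}

/-- **RATE-SMALL CONSTANTS + MULTIPLICITY ⇒ `|κ₂ j| ≤ ρ_j`**: constants `|c_X| ≤ Cr θ^{scale X} e^{−κd(X)}` on the ledger
and slice multiplicity `Cw·vol·Λ^{K−j}` ((0.26), one run) bound the scale-`j` rate centre `Σ_{scale X = j} c_X` by
`Cw·vol·(Cr θ^j Λ^{K−j})` (`T4TowerRateComposition.rateSlice_le`). [folklore] -/
theorem abs_rateCentre_le {fac : Finset C.Dom} {c : C.Dom → ℝ} {Cw vol Λ Cr θ κ : ℝ} {K : ℕ}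
    (hc : ∀ X ∈ fac, |c X| ≤ Cr * θ ^ C.scale X * Real.exp (-(κ * C.d X)))
    (hM : Multiplicity fac C.scale (fun X => Real.exp (-(κ * C.d X))) Cw vol Λ K) (hCr : 0 ≤ Cr) (hθ : 0 ≤ θ)
    {j : ℕ} (hj : j ≤ K) :
    |∑ X ∈ fac with C.scale X = j, c X| ≤ Cw * vol * (Cr * θ ^ j * Λ ^ (K - j)) :=
  calc |∑ X ∈ fac with C.scale X = j, c X| ≤ ∑ X ∈ fac with C.scale X = j, |c X| := abs_sum_le_sum_abs _ _
    _ ≤ ∑ X ∈ fac with C.scale X = j, Cr * θ ^ C.scale X * Real.exp (-(κ * C.d X)) :=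
        sum_le_sum fun X hX => hc X (mem_filter.mp hX).1
    _ ≤ Cw * vol * (Cr * θ ^ j * Λ ^ (K - j)) := rateSlice_le hM hCr hθ hj

open FlowStep T4CouplingMatching in
/-- **THE FIELD-INDEPENDENT CONSTANTS ARE RATE-SMALL ALONG THE TOWER, FROM THE IN-EDGES BY NAME.**  N22 = `NE9 ∧
FadingMemory`, N18 = `NE5` (worsened to `θ′`, `ne5_mono`), node U2's OUTPUT `InjectedRate (2c∕(1−θc)) 0 θc disc` for the
tower table `g` (from N17 = `ScaleShiftRate` and its displayed inputs, `injectedRate_of_runs_eventual`), both runs' sequences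
in `W`, `max(ω, θc) < θ′`, and the structural `C.transport oneB = oneA` ⇒ at EVERY cutoff `K` and domain `X` of scale `≤ K`:
`|E^B(X; g^B_K, 1_B) − E^A(X; g^A_K, 1_A)| ≤ (b + C₅)·θ′^{scale X}·e^{−κd(X)}`, `b = C₉·(γ³·(2c∕(1−θc)))·θ′∕(θ′ − max(ω,θc))`
(`abs_const_sub_le` + `couplingRate_pair_of_injectedDisc` + `historySum_le_rate_of_lt`).  CONDITIONAL on every binder. [folklore] -/
theorem abs_const_sub_le_tower {W : Set (ℕ → ℝ)} {EA : Functional C C.BgA} {EB : Functional C C.BgB} {β : HBeta}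
    {κ θ₅ C₅ C₉ ω θc γ b c Cβ θ' : ℝ} {k₀ : ℕ} {Λ Λβ : ℕ → ℕ → ℝ} {g : ℕ → ℕ → ℝ} {oneA : C.BgA} {oneB : C.BgB}
    (gIR : ℝ) (h22 : NE9 EA W κ Λ ∧ T4OutputRate.FadingMemory C₉ ω Λ) (hω : 0 ≤ ω)
    (h18 : NE5 EA EB W κ θ₅ C₅) (hθ₅ : 0 ≤ θ₅) (hC₅ : 0 ≤ C₅)
    (h17 : ScaleShiftRate c θc γ β)
    (hγ : 0 < γ) (hb : 0 < b) (hθc0 : 0 < θc) (hθc1 : θc < 1) (hc : 0 ≤ c) (hCβ : 0 ≤ Cβ)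
    (hrun : ∀ K, RGEqH K β (g K)) (hbox : ∀ K i, i ≤ K → 0 < g K i ∧ g K i ≤ γ) (hpin : ∀ K, g K K = gIR)
    (hL : HistLipschitz Λβ γ β) (hΛβ : T4CouplingMatching.FadingMemory Cβ θc Λβ)
    (hlo : EventualLowerH b γ k₀ β) (hsmall : Cβ * (((k₀ : ℝ) + 1) * γ ^ 3 + 2 * γ / b) ≤ (1 - θc) / 2)
    (hgA : ∀ K, g K ∈ W) (hgB : ∀ K, (fun i => g (K + 1) (i + 1)) ∈ W)
    (hθ' : max ω θc < θ') (hθ₅' : θ₅ ≤ θ') (hone : C.transport oneB = oneA)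
    (K : ℕ) (X : C.Dom) (hX : C.scale X ≤ K) :
    |EB (fun i => g (K + 1) (i + 1)) oneB X - EA (g K) oneA X|
      ≤ (C₉ * (γ ^ 3 * (2 * c / (1 - θc))) * (θ' / (θ' - max ω θc)) + C₅) * θ' ^ C.scale X
          * Real.exp (-(κ * C.d X)) := by
  have hinj := injectedRate_of_runs_eventual g gIR hγ hb hθc0 hθc1 hc hCβ hrun hbox hpin h17 hL hΛβ hlo hsmall
  have hD : 0 ≤ γ ^ 3 * (2 * c / (1 - θc)) :=
    mul_nonneg (pow_nonneg hγ.le 3) (div_nonneg (mul_nonneg zero_le_two hc) (by linarith))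
  have hcoup : ∀ i < C.scale X, |g K i - (fun n => g (K + 1) (n + 1)) i| ≤ γ ^ 3 * (2 * c / (1 - θc)) * θc ^ i :=
    fun i hi => couplingRate_pair_of_injectedDisc hinj hbox K i (by omega)
  have hbX := historySum_le_rate_of_lt h22.2 hω hθc0.le hD hθ' hcoup
  exact abs_const_sub_le h22.1 (ne5_mono h18 hθ₅ hθ₅' hC₅) (hgA K) (hgB K) hone X hbX

end Constants

/-! ## §3 THE KNIT v2: N16 · N17 · N18 · N22 by name, size binder zero-centred, (D) replaced by the other-kinds centre clause -/

section SpineNodes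

open FlowStep T4CouplingMatching

variable {C : Carriers} {ι X : Type} [MeasurableSpace ι] {σ : Type*} [DecidableEq σ] {l₀ vol : ℝ}
  {T : ℕ → Finset σ} {Bad : ℕ → ℝ → Finset σ} {P Q : ℕ → ℝ → σ → ℝ} {μ : ℕ → ℝ → σ → Measure ι}
  {fac : ℕ → ℝ → σ → Finset C.Dom} {R : Readings ι X} {W : Set (ℕ → ℝ)} {EA : Functional C C.BgA}
  {EB : Functional C C.BgB} {β : HBeta} {κ θ₅ C₅ C₉ ω θc γ b c Cβ C₃ θ₃ Pg θ' : ℝ} {q k₀ m : ℕ} {Λ Λβ : ℕ → ℕ → ℝ}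
  {CU : (ℕ → ℝ) → ℕ → ℝ} {g : ℕ → ℕ → ℝ} {uA : ℕ → ι → C.BgA} {uB : ℕ → ι → C.BgB} {oneA : C.BgA} {oneB : C.BgB}
  {oA oB : ℕ → ℝ → σ → ι → ℝ} {S : ℕ → ℝ → σ → ℕ → ℝ} {cO RO : ℕ → ℝ → σ → ℝ} {rO : ℕ → ℝ} {Cw E₀ a Λg : ℝ}

/-- **NODE N19 KNIT BY NAME FROM ITS IN-EDGES, v2 — HAZARD H-U5b-1 FOR THE E-LEDGER SUPPLIED BY THE IN-EDGES.**  Hypotheses: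
exactly those of `N19CoreKnit.core_summable_of_spineNodes` (N16 `NE3Shape` + `GaugeDominated`; N17 `ScaleShiftRate` + node U2's
displayed inputs incl. the UNPRINTED floor `EventualLowerH`; N18 `NE5`; N22 `NE9 ∧ FadingMemory`; node U3's printed-ingredient
bracket; window; common rate `θ′ < 1`; the END's format binders on `R.dom`; multiplicity; other kinds centred at `cO` within
`RO ≤ vol·rO K`, `Σ rO < ∞`; the (2.43)-window size profile) EXCEPT: the SIZE binder is ZERO-CENTRED (`|slice| ≤ S`, as
(2.43) is printed) and binder (D) `hdevU` is REPLACED by `hone : C.transport oneB = oneA` and the OTHER-KINDS CENTRE CLAUSE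
`hcO : ∃ c₀ s, Summable s ∧ |cO K t τ − c₀ K| ≤ vol·s K` on the good class.  CONCLUSION (unchanged): `∃ δ, Spine.NE7.Core l₀
vol T Bad P Q δ ∧ Summable δ` — N19 BY NAME ∧ node U4′'s summable leaf.  Proof: `uRateUpTo_of_spine` (`Cr = a₀ + b + C₅`);
§2 (`b + C₅ ≤ Cr` ⇒ `|κ₂ j| ≤ ρ_j`); §1 gives the `hdev` binder of `N19CoreKnit.termBudget_of_towerRate_sizeProfile` with
`s′_K = max(Cw,1)(E₀(K+1)^m + Cr)Σmin + s_K` (summable); `core_summable_of_termBudget`.  CONDITIONAL on every binder; nothing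
of Bałaban's is instantiated; NOT NE7. [folklore] -/
theorem core_summable_of_spineNodes_sync (gIR : ℝ)
    -- the in-edges BY NAME
    (h16 : NE3Shape R C₃ θ₃) (hC₃ : 0 ≤ C₃) (hgd : GaugeDominated R uA uB)
    (h17 : ScaleShiftRate c θc γ β)
    (h18 : NE5 EA EB W κ θ₅ C₅) (hθ₅ : 0 ≤ θ₅) (hC₅ : 0 ≤ C₅)
    (h22 : NE9 EA W κ Λ ∧ T4OutputRate.FadingMemory C₉ ω Λ) (hω : 0 ≤ ω)
    -- node U2's other displayed inputs (binders of `injectedRate_of_runs_eventual`)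
    (hγ : 0 < γ) (hb : 0 < b) (hθc0 : 0 < θc) (hθc1 : θc < 1) (hc : 0 ≤ c) (hCβ : 0 ≤ Cβ)
    (hrun : ∀ K, RGEqH K β (g K)) (hbox : ∀ K i, i ≤ K → 0 < g K i ∧ g K i ≤ γ) (hpin : ∀ K, g K K = gIR)
    (hL : HistLipschitz Λβ γ β) (hΛβ : T4CouplingMatching.FadingMemory Cβ θc Λβ)
    (hlo : EventualLowerH b γ k₀ β) (hsmall : Cβ * (((k₀ : ℝ) + 1) * γ ^ 3 + 2 * γ / b) ≤ (1 - θc) / 2)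
    -- node U3's printed-ingredient bracket, the window, the common rate
    (hU : LipBackground EA W κ CU) (hG : PolyLipGrowth CU g Pg q) (hPg : 0 ≤ Pg)
    (hgA : ∀ K, g K ∈ W) (hgB : ∀ K, (fun i => g (K + 1) (i + 1)) ∈ W)
    (hθ' : max ω θc < θ') (hθ₅' : θ₅ ≤ θ') (hθ₃' : θ₃ ≤ θ') (hθ'1 : θ' < 1) (hθ'Λ : θ' ≤ Λg)
    -- the END's format binders on `R.dom`
    (hfmtA : ∀ K t τ, P K t τ = ∫ v, (∏ X ∈ fac K t τ,
      Real.exp (EA (g K) (uA K v) X - EA (g K) oneA X)) * oA K t τ v ∂(μ K t τ))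
    (hfmtB : ∀ K t τ, Q K t τ = ∫ v, (∏ X ∈ fac K t τ,
      Real.exp (EB (fun i => g (K + 1) (i + 1)) (uB K v) X - EB (fun i => g (K + 1) (i + 1)) oneB X)) *
        oB K t τ v ∂(μ K t τ))
    (hint : ∀ K t, |t| ≤ l₀ → ∀ τ ∈ T K \ Bad K t,
      Integrable (fun v => (∏ X ∈ fac K t τ, Real.exp (EA (g K) (uA K v) X - EA (g K) oneA X)) *
        oA K t τ v) (μ K t τ) ∧
      Integrable (fun v => (∏ X ∈ fac K t τ,
        Real.exp (EB (fun i => g (K + 1) (i + 1)) (uB K v) X - EB (fun i => g (K + 1) (i + 1)) oneB X)) *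
        oB K t τ v) (μ K t τ))
    (hsc : ∀ K t, |t| ≤ l₀ → ∀ τ ∈ T K \ Bad K t, ∀ X ∈ fac K t τ, C.scale X ≤ K)
    (hposO : ∀ K t, |t| ≤ l₀ → ∀ τ ∈ T K \ Bad K t, ∀ v ∈ R.dom, 0 < oA K t τ v ∧ 0 < oB K t τ v)
    (hoff : ∀ K t, |t| ≤ l₀ → ∀ τ ∈ T K \ Bad K t, ∀ v, v ∉ R.dom →
      (∏ X ∈ fac K t τ, Real.exp (EA (g K) (uA K v) X - EA (g K) oneA X)) * oA K t τ v = 0 ∧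
      (∏ X ∈ fac K t τ,
        Real.exp (EB (fun i => g (K + 1) (i + 1)) (uB K v) X - EB (fun i => g (K + 1) (i + 1)) oneB X)) *
        oB K t τ v = 0)
    -- the SIZE binder, ZERO-CENTRED as (2.43) is printed, in the (2.43)-window profile (`m = 0` = all-regular)
    (hS : ∀ K t, |t| ≤ l₀ → ∀ τ ∈ T K \ Bad K t, ∀ v ∈ R.dom, ∀ j ≤ K,
      |∑ X ∈ fac K t τ with C.scale X = j,
          (Real.log (Real.exp (EB (fun i => g (K + 1) (i + 1)) (uB K v) X
              - EB (fun i => g (K + 1) (i + 1)) oneB X))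
            - Real.log (Real.exp (EA (g K) (uA K v) X - EA (g K) oneA X)))| ≤ S K t τ j)
    (hvol : 0 ≤ vol) (hE₀ : 0 ≤ E₀) (ha0 : 0 < a) (ha1 : a < 1)
    (hSle : ∀ K t, |t| ≤ l₀ → ∀ τ ∈ T K \ Bad K t, ∀ j ≤ K,
      S K t τ j ≤ vol * (E₀ * ((K : ℝ) + 1) ^ m * a ^ (K - j)))
    -- MULTIPLICITY ((0.26), one run) and the OTHER KINDS: per-term centre `cO` within `RO ≤ vol·rO K`, `Σ rO < ∞`
    (hM : ∀ K t, |t| ≤ l₀ → ∀ τ ∈ T K \ Bad K t,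
      Multiplicity (fac K t τ) C.scale (fun X => Real.exp (-(κ * C.d X))) Cw vol Λg K)
    (hO : ∀ K t, |t| ≤ l₀ → ∀ τ ∈ T K \ Bad K t, ∀ v ∈ R.dom,
      |Real.log (oB K t τ v) - Real.log (oA K t τ v) - cO K t τ| ≤ RO K t τ)
    (hRO : ∀ K t, |t| ≤ l₀ → ∀ τ ∈ T K \ Bad K t, RO K t τ ≤ vol * rO K) (hrO : Summable rO)
    -- NEW in v2, replacing (D): run B's unit background transports to run A's, and the OTHER-KINDS CENTRE CLAUSE (O′)
    (hone : C.transport oneB = oneA)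
    (hcO : ∃ c₀ s : ℕ → ℝ, Summable s ∧ ∀ K t, |t| ≤ l₀ → ∀ τ ∈ T K \ Bad K t, |cO K t τ - c₀ K| ≤ vol * s K) :
    ∃ δ : ℕ → ℝ, NE7.Core l₀ vol T Bad P Q δ ∧ Summable δ := by
  -- node U3 composed along the tower, `K`-uniform constant `Cr = a₀ + b + C₅` (as in the knit v1)
  obtain ⟨a₀, ha₀, hUK⟩ := uRateUpTo_of_spine gIR h22.1 h22.2 hω hU hG hPg h18 hθ₅ hC₅ h16.pointwise hC₃ h16.rate_nonneg
    h16.rate_lt_one hgd hγ hb hθc0 hθc1 hc hCβ hrun hbox hpin h17 hL hΛβ hlo hsmall hgA hgB hθ' hθ₅' hθ₃'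
  have hθ'0 : 0 < θ' := lt_of_le_of_lt (hθc0.le.trans (le_max_right ω θc)) hθ'
  have hC₉ : 0 ≤ C₉ := fadingMemory_const_nonneg h22.2
  have hbr0 : 0 ≤ C₉ * (γ ^ 3 * (2 * c / (1 - θc))) * (θ' / (θ' - max ω θc)) := by
    have h1 : 0 ≤ 2 * c / (1 - θc) := div_nonneg (mul_nonneg zero_le_two hc) (by linarith)
    have h2 : 0 ≤ θ' / (θ' - max ω θc) := div_nonneg hθ'0.le (sub_pos.mpr hθ').le
    exact mul_nonneg (mul_nonneg hC₉ (mul_nonneg (pow_nonneg hγ.le 3) h1)) h2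
  set Cr := a₀ + C₉ * (γ ^ 3 * (2 * c / (1 - θc))) * (θ' / (θ' - max ω θc)) + C₅ with hCr_def
  have hCr : 0 ≤ Cr := add_nonneg (add_nonneg ha₀ hbr0) hC₅
  -- §2: the field-independent constants are rate-small with constant `b + C₅ ≤ Cr`, at every cutoff
  have hconst : ∀ K (X : C.Dom), C.scale X ≤ K →
      |(-(EB (fun i => g (K + 1) (i + 1)) oneB X - EA (g K) oneA X))|
        ≤ Cr * θ' ^ C.scale X * Real.exp (-(κ * C.d X)) := fun K X hX => by
    rw [abs_neg]
    refine (abs_const_sub_le_tower gIR h22 hω h18 hθ₅ hC₅ h17 hγ hb hθc0 hθc1 hc hCβ hrun hbox hpin hL hΛβ hlo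
      hsmall hgA hgB hθ' hθ₅' hone K X hX).trans ?_
    refine mul_le_mul_of_nonneg_right (mul_le_mul_of_nonneg_right ?_ (pow_nonneg hθ'0.le _))
      (Real.exp_pos _).le
    rw [hCr_def]
    linarith
  -- hence the rate centres are within their radii on every good term's ledger (multiplicity)
  have hκ : ∀ K t, |t| ≤ l₀ → ∀ τ ∈ T K \ Bad K t, ∀ j ≤ K,
      |∑ X ∈ fac K t τ with C.scale X = j, (-(EB (fun i => g (K + 1) (i + 1)) oneB X - EA (g K) oneA X))|
        ≤ Cw * vol * (Cr * θ' ^ j * Λg ^ (K - j)) := fun K t ht τ hτ j hj =>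
    abs_rateCentre_le (fun X hX => hconst K X (hsc K t ht τ hτ X hX)) (hM K t ht τ hτ) hCr hθ'0.le hj
  -- §1: the `hdev` binder of the knit's budget theorem, for THIS `Cr`, with a summable `s′`
  obtain ⟨c₀, s, hs, hcO'⟩ := hcO
  have hdev : ∀ K t, |t| ≤ l₀ → ∀ τ ∈ T K \ Bad K t,
      |((∑ j ∈ range (K + 1), sliceCentre (fun _ => 0)
          (fun j => ∑ X ∈ fac K t τ with C.scale X = j,
            (-(EB (fun i => g (K + 1) (i + 1)) oneB X - EA (g K) oneA X)))
          (S K t τ) (fun j => Cw * vol * (Cr * θ' ^ j * Λg ^ (K - j))) j) + cO K t τ) - c₀ K|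
        ≤ vol * (max Cw 1 * ((E₀ * ((K : ℝ) + 1) ^ m + Cr)
            * ∑ x ∈ antidiagonal K, min (a ^ x.2) (θ' ^ x.1 * Λg ^ x.2)) + s K) := fun K t ht τ hτ =>
    abs_centre_sub_le hvol (by positivity) ha0.le hθ'0.le (hθ'0.le.trans hθ'Λ) hCr (hκ K t ht τ hτ)
      (hSle K t ht τ hτ) (fun j _ => le_rfl) (hcO' K t ht τ hτ)
  -- the knit's budget theorem with the size centre `0`, then `Core ∧ Summable`
  have hT := termBudget_of_towerRate_sizeProfile (κ₁ := fun _ _ _ _ => 0) (E := fun K : ℕ => E₀ * ((K : ℝ) + 1) ^ m)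
    (s := fun K => max Cw 1 * ((E₀ * ((K : ℝ) + 1) ^ m + Cr)
      * ∑ x ∈ antidiagonal K, min (a ^ x.2) (θ' ^ x.1 * Λg ^ x.2)) + s K)
    hUK hCr hθ'0.le (hθ'0.le.trans hθ'Λ) hfmtA hfmtB hint hsc hposO hoff
    (fun K t ht τ hτ v hv j hj => by simpa only [sub_zero] using hS K t ht τ hτ v hv j hj)
    hM hO hvol (fun K => by positivity) ha0.le hSle hRO hdev
  have hsum := summable_eBranch_windowSize (m := m) hE₀ hCr ha0 ha1 hθ'0 hθ'1 hθ'Λ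
  exact ⟨_, core_summable_of_termBudget hT hsum hrO ((hsum.mul_left (max Cw 1)).add hs)⟩

end SpineNodes

/-! ## §4 Non-vacuity: the v2 binder set is met by toy data (those of `N19CoreKnitSanity` with `C₅ = 1`), and the knit v2 fires -/

section Sanity

open FlowStep T4CouplingMatching
open Summit.QuantumFields.YangMills.BalabanUVNodes.N19CoreKnitSanity (toy_running toy_beta)

/-- **NON-VACUITY OF THE KNIT v2.**  For `0 < q < 1`, `0 < b`, `0 < gIR` the toy assignment of
`BalabanUVNodesN19CoreKnitSanity.spineNodes_nonvacuous` but with a GENUINE functional-bracket discrepancy `C₅ = 1` (rates `θ₅ = ω = θc = θ₃ = a = q`, `θ′ = (1+q)∕2`, `Λ = 1`, running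
couplings of the constant β-function `b` pinned at `gIR`, one good term per cutoff, E-ledger `range (K+1)`, unit backgrounds
`0`, identity transport) meets ALL binders of `core_summable_of_spineNodes_sync` — with the ZERO-CENTRED size binder
`S K j = (1 − q)·q^{K+j}` (the toy slice is `q^j(q^{K+1} − q^K)`), `hone` by `rfl`, `cO ≡ c₀ ≡ s ≡ 0` — and the conclusion
fires.  Consistency of the binder SET only; no physics (the toy constants `c_X` are a genuine coupling-history difference,
rate-small by §2, so §1–§2 are exercised). [folklore] -/
theorem spineNodes_sync_nonvacuous {q b gIR : ℝ} (hq0 : 0 < q) (hq1 : q < 1) (hb : 0 < b) (hgIR : 0 < gIR) :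
    ∃ δ : ℕ → ℝ, NE7.Core (ι := Unit) 1 1 (fun _ => Finset.univ) (fun _ _ => ∅)
        (fun K _ _ => ∫ _v, (∏ X ∈ range (K + 1),
          Real.exp (toyEA q q (fun k => (Real.sqrt ((gIR ^ 2)⁻¹ + b * ((K - k : ℕ) : ℝ)))⁻¹) (q ^ K) X
            - toyEA q q (fun k => (Real.sqrt ((gIR ^ 2)⁻¹ + b * ((K - k : ℕ) : ℝ)))⁻¹) 0 X)) * 1
          ∂(Measure.dirac ()))
        (fun K _ _ => ∫ _v, (∏ X ∈ range (K + 1),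
          Real.exp (toyEB q q 1 (fun i => (Real.sqrt ((gIR ^ 2)⁻¹ + b * ((K + 1 - (i + 1) : ℕ) : ℝ)))⁻¹) (q ^ (K + 1)) X
            - toyEB q q 1 (fun i => (Real.sqrt ((gIR ^ 2)⁻¹ + b * ((K + 1 - (i + 1) : ℕ) : ℝ)))⁻¹) 0 X)) * 1
          ∂(Measure.dirac ()))
        δ ∧ Summable δ := by
  -- the tree's toy node shapes (NE9, fading memory, Lipschitz-in-U, NE5; NE3's local rate, gauge domination)
  obtain ⟨h9, hΛ, hU, h5⟩ := toy_nonvacuous (C₅ := 1) hq0.le hq1.le hq0.le zero_le_one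
  obtain ⟨hloc, hgd, -, -, -⟩ := toy_nodes_hypotheses (θc := q) (γ := gIR) hq0.le hq1.le hgIR
  obtain ⟨hrun, hpin, hbox⟩ := toy_running hb.le hgIR
  obtain ⟨hS, hL, hΛβ, hlo, hsmall⟩ := toy_beta (b := b) (γ := gIR) hq1.le
  have h16 : NE3Shape
      ({ dom := Set.univ, act := fun _ _ => 0, loc := fun k _ _ => q ^ k, vol := 0, vol_nonneg := le_rfl } :
        Readings Unit Unit) 1 q :=
    { rate_nonneg := hq0.le, rate_lt_one := hq1, action := fun k V _ => by simp, pointwise := hloc }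
  have hθ' : max q q < (1 + q) / 2 := by rw [max_self]; linarith
  have hqθ' : q ≤ (1 + q) / 2 := by linarith
  have hθ'1 : (1 + q) / 2 < 1 := by linarith
  refine core_summable_of_spineNodes_sync (C := toyCarriers) (σ := Unit) (W := Set.univ) (EA := toyEA q q)
    (EB := toyEB q q 1) (β := fun _ _ => b) (Λ := fun k i => q ^ (k - i)) (Λβ := fun _ _ => 0)
    (CU := fun _ _ => (1 : ℝ)) (g := fun K k => (Real.sqrt ((gIR ^ 2)⁻¹ + b * ((K - k : ℕ) : ℝ)))⁻¹)
    (uA := fun K _ => (q ^ K : ℝ)) (uB := fun K _ => (q ^ (K + 1) : ℝ)) (oneA := (0 : ℝ)) (oneB := (0 : ℝ))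
    (oA := fun _ _ _ _ => 1) (oB := fun _ _ _ _ => 1) (μ := fun _ _ _ => Measure.dirac ())
    (fac := fun K _ _ => range (K + 1)) (S := fun K _ _ j => (1 - q) * q ^ (K + j))
    (cO := fun _ _ _ => 0) (RO := fun _ _ _ => 0) (rO := fun _ => 0)
    (Cw := 1) (E₀ := 1) (a := q) (Λg := 1) (m := 0) (κ := 0) (Pg := 1) (q := 0) (k₀ := 0)
    gIR h16 zero_le_one hgd hS h5 hq0.le zero_le_one ⟨h9, hΛ⟩ hq0.le hgIR hb hq0 hq1 le_rfl le_rfl hrun hbox hpin hL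
    hΛβ hlo hsmall hU (fun K j _ => ⟨zero_le_one, by simp⟩) zero_le_one (fun _ => Set.mem_univ _)
    (fun _ => Set.mem_univ _) hθ' hqθ' hqθ' hθ'1 hθ'1.le
    (fun _ _ _ => rfl) (fun _ _ _ => rfl) (fun _ _ _ _ _ => ⟨Integrable.of_finite, Integrable.of_finite⟩)
    (fun K _ _ _ _ X hX => Nat.le_of_lt_succ (mem_range.mp hX)) (fun _ _ _ _ _ _ _ => ⟨one_pos, one_pos⟩)
    (fun _ _ _ _ _ v hv => absurd (Set.mem_univ v) hv) (fun K t _ τ _ v _ j hj => ?_)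
    zero_le_one zero_le_one hq0 hq1 (fun K t _ τ _ j hj => ?_) (fun K t _ τ _ j hj => ?_)
    (fun _ _ _ _ _ _ _ => by simp) (fun _ _ _ _ _ => by simp) summable_zero rfl
    ⟨fun _ => 0, fun _ => 0, summable_zero, fun K t _ τ _ => by simp⟩
  · -- `hS`: the zero-centred toy slice is `q^j(q^{K+1} − q^K)`, of size `(1 − q)q^{K+j}`
    show |∑ X ∈ range (K + 1) with X = j,
        (Real.log (Real.exp (toyEB q q 1
            (fun i => (Real.sqrt ((gIR ^ 2)⁻¹ + b * ((K + 1 - (i + 1) : ℕ) : ℝ)))⁻¹) (q ^ (K + 1)) X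
          - toyEB q q 1 (fun i => (Real.sqrt ((gIR ^ 2)⁻¹ + b * ((K + 1 - (i + 1) : ℕ) : ℝ)))⁻¹) 0 X))
          - Real.log (Real.exp (toyEA q q (fun k => (Real.sqrt ((gIR ^ 2)⁻¹ + b * ((K - k : ℕ) : ℝ)))⁻¹) (q ^ K) X
          - toyEA q q (fun k => (Real.sqrt ((gIR ^ 2)⁻¹ + b * ((K - k : ℕ) : ℝ)))⁻¹) 0 X)))|
      ≤ (1 - q) * q ^ (K + j)
    rw [Finset.filter_eq', if_pos (mem_range.mpr (Nat.lt_succ_of_le hj)), sum_singleton, Real.log_exp,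
      Real.log_exp]
    simp only [toyEA, toyEB]
    have e : q ^ j * q ^ (K + 1) + ∑ i ∈ range j, q ^ (j - i) *
          (Real.sqrt ((gIR ^ 2)⁻¹ + b * ((K + 1 - (i + 1) : ℕ) : ℝ)))⁻¹ - 1 * q ^ j
        - (q ^ j * 0 + ∑ i ∈ range j, q ^ (j - i) *
          (Real.sqrt ((gIR ^ 2)⁻¹ + b * ((K + 1 - (i + 1) : ℕ) : ℝ)))⁻¹ - 1 * q ^ j)
        - (q ^ j * q ^ K + ∑ i ∈ range j, q ^ (j - i) * (Real.sqrt ((gIR ^ 2)⁻¹ + b * ((K - i : ℕ) : ℝ)))⁻¹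
          - (q ^ j * 0 + ∑ i ∈ range j, q ^ (j - i) * (Real.sqrt ((gIR ^ 2)⁻¹ + b * ((K - i : ℕ) : ℝ)))⁻¹))
        = -((1 - q) * q ^ (K + j)) := by ring
    rw [e, abs_neg, abs_of_nonneg (mul_nonneg (by linarith) (pow_nonneg hq0.le _))]
  · -- `hSle`: `(1 − q)q^{K+j} ≤ 1·(1·(K+1)^0·q^{K−j})`
    show (1 - q) * q ^ (K + j) ≤ 1 * (1 * ((K : ℝ) + 1) ^ 0 * q ^ (K - j))
    rw [pow_zero, one_mul, one_mul, one_mul]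
    exact (mul_le_of_le_one_left (pow_nonneg hq0.le _) (by linarith)).trans
      (pow_le_pow_of_le_one hq0.le hq1.le (by omega))
  · -- `hM`: one domain per scale, weight `e^0 = 1 ≤ 1·1·1^{K−j}`
    show ∑ i ∈ range (K + 1) with i = j, Real.exp (-(0 * (0 : ℝ))) ≤ 1 * 1 * (1 : ℝ) ^ (K - j)
    rw [Finset.filter_eq', if_pos (mem_range.mpr (Nat.lt_succ_of_le hj)), sum_singleton]
    simp

end Sanity

end Summit.QuantumFields.YangMills.BalabanUVNodes.N19CentreSync
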